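import Summits.BirchSwinnertonDyer.Rank1Residual.P2.CongruentNumberEvenPairSelmerAoki
import HarnessLib

/-!
# Cell `bsd-monsky`: AOKI = MONSKY AT `k = 2` — Aoki's closed formula equals Monsky's matrix count `s(2pq) + 2`
# on EVERY even two-prime cell `n = 2pq ≡ 6 (mod 8)`, so Aoki's refereed Theorem 2.2 gives the `k = 2`
# instance of Heath-Brown 1994's formula `#Sel₂(E_n) = 2^{2 + s(n)}` (nothing asserted)

HONEST FRAMING (cell `bsd-monsky`, run/shared/lean/pub/bsd-monsky/, README §1: ONE theorem on ONE explicit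
infinite family of quadratic twists of the congruent number curve at the prime `2`; not "BSD for rank ≤ 1",
nothing at odd primes, nothing booked until the cross-family referee passes the written proof). This file
asserts NO arithmetic fact. With the evaluations of `P2/CongruentNumberSilentEvenFiveSelmerEightAoki.lean`
(`p ≡ 5 (mod 8)`: `dim = 3`) and `P2/CongruentNumberEvenPairSelmerAoki.lean` (`p ≡ 1 (mod 8)`: `dim = 3` for
`(p/q) = −1`, `5` for `(p/q) = +1`) and the landed table route for Monsky's even matrix
(`P2/CongruentNumberPairsAtTwoEvenPairTable.lean`: `s = 1` on the `p ≡ 5 (8)` row, `s = 3` on `p ≡ 1 (8)`,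
`(p/q) = +1`):

* §1 Monsky's even matrix on the remaining row: `s(2pq) = 1` for `p ≡ 1 (mod 8)`, `(p/q) = −1`, in either
  tuple order (`monskySelmerRankEven_one_pair_of_jacobiSym_eq_neg_one`), and the swapped tuple order of the
  `p ≡ 5 (mod 8)` row (`monskySelmerRankEven_five_pair_swap`) — four counted kernels of the `4 × 4` table
  matrix each (`decide +kernel`).
* §2 **`selmerDimFormula (2pq) = s(2pq) + 2` for EVERY ordered pair `p ≡ 1 (4)`, `q ≡ 3 (4)`**
  (`selmerDimFormula_two_mul_pair`, `…_swap`), hence **`#Sel₂(E_{2t₀t₁}) = 2^{2 + s(t)}` for every `k = 2` cell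
  `2t₀t₁ ≡ 6 (mod 8)` from `hAo` alone** (`card_selmerGroup_two_two_mul_prod_two_of_aoki`): the `k = 2` instance
  of the named fact `HeathBrown1994.monsky_card_selmerGroup_two_even` (`hMe`, whose even case is printed as
  a sketch proof) follows from a refereed theorem with complete proof. (lit's numerical control
  `lit/aoki1999-control/`: Aoki = Monsky on 60 801/60 801 square-free `n < 2·10⁵`; here the `k = 2` cells in
  the kernel, symbolically.)

References: [Aoki1999] Thm. 2.2 p. 81; [HeathBrown1994SelmerCongruentII] Appendix (Monsky), typescript
p. 41 L20–L36; [SilvermanAEC2009] Thm. X.4.2.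
-/

noncomputable section

open scoped Classical

open WeierstrassCurve Literature.NumberTheory.EllipticCurves
  Literature.NumberTheory.EllipticCurves.Aoki1999
  Literature.NumberTheory.EllipticCurves.Rank1Residual
  Literature.NumberTheory.EllipticCurves.Rank1Residual.Typed
  Literature.NumberTheory.EllipticCurves.HeathBrown1994
  Literature.NumberTheory.EllipticCurves.HeathBrown1994.Families
  Literature.NumberTheory.EllipticCurves.Monsky1990
  Literature.NumberTheory.QuadraticForms

set_option autoImplicit false

namespace Summit.BirchSwinnertonDyer.Rank1Residual.P2

open Conjectures Literature.NumberTheory.EllipticCurves.Tian2014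

/-! ## §1 Monsky's even matrix on the same cells: `s(2pq) = 1` for `p ≡ 1 (mod 8)`, `(p/q) = −1` (either order),
and the swapped order of the `p ≡ 5 (mod 8)` row -/

section Monsky

variable {p q : ℕ}

/-- **The row `p ≡ 1 (mod 8)`, `(p/q) = −1`: `s(2pq) = 1` in EITHER tuple order** — the table route with
`a = 1`, `d = (0, [q ≡ 3 (8)])`, `e = (0, 1)` at `(p, q)`; four counted kernels of size `2`. Pure linear
algebra, no named fact. [cite: HeathBrown1994SelmerCongruentII, Appendix (Monsky), typescript p. 41 L20–L36] -/
theorem monskySelmerRankEven_one_pair_of_jacobiSym_eq_neg_one (hp : p.Prime) (hq : q.Prime)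
    (hp1 : p % 8 = 1) (hq4 : q % 4 = 3) (hj : jacobiSym p q = -1) :
    monskySelmerRankEven ![p, q] = 1 ∧ monskySelmerRankEven ![q, p] = 1 := by
  have hp4 : p % 4 = 1 := by omega
  have hqodd : Odd q := Nat.odd_iff.mpr (by omega)
  have ht : ∀ i, (![p, q] i).Prime := fun i => by fin_cases i <;> assumption
  have ht' : ∀ i, (![q, p] i).Prime := fun i => by fin_cases i <;> assumption
  obtain ⟨hqp, hpq⟩ := addLegendreSym_pair_of_jacobiSym_eq_neg_one hp4 hqodd hj
  have hdp : addLegendreSym 2 p = 0 := addLegendreSym_of_eq_one (jacobiSym_two_eq_one (Or.inl hp1))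
  have hep : addLegendreSym (-1) p = 0 := addLegendreSym_of_eq_one (jacobiSym_neg_one_eq_one hp4)
  have heq : addLegendreSym (-1) q = 1 :=
    addLegendreSym_of_eq_neg_one (DeuringLadic.jacobiSym_neg_one_of_mod_four hq4)
  rcases (show q % 8 = 3 ∨ q % 8 = 7 by omega) with h3 | h7
  · have hdq : addLegendreSym 2 q = 1 := addLegendreSym_of_eq_neg_one (jacobiSym_two_eq_neg_one (Or.inl h3))
    exact ⟨monskySelmerRankEven_pair_eq_of_bits _ ht 1 0 1 0 1 hqp hpq hdp hdq hep heq (by decide +kernel),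
      monskySelmerRankEven_pair_eq_of_bits _ ht' 1 1 0 1 0 hpq hqp hdq hdp heq hep (by decide +kernel)⟩
  · have hdq : addLegendreSym 2 q = 0 := addLegendreSym_of_eq_one (jacobiSym_two_eq_one (Or.inr h7))
    exact ⟨monskySelmerRankEven_pair_eq_of_bits _ ht 1 0 0 0 1 hqp hpq hdp hdq hep heq (by decide +kernel),
      monskySelmerRankEven_pair_eq_of_bits _ ht' 1 0 0 1 0 hpq hqp hdq hdp heq hep (by decide +kernel)⟩

/-- **The row `p ≡ 5 (mod 8)` in the swapped tuple order: `s(2qp) = 1`** (the landed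
`monskySelmerRankEven_five_pair` is the order `![p, q]`). [cite: HeathBrown1994SelmerCongruentII, Appendix (Monsky), typescript p. 41 L20–L36] -/
theorem monskySelmerRankEven_five_pair_swap (hp : p.Prime) (hq : q.Prime) (hp5 : p % 8 = 5)
    (hq4 : q % 4 = 3) : monskySelmerRankEven ![q, p] = 1 := by
  have hp4 : p % 4 = 1 := by omega
  have hne : p ≠ q := fun h => by omega
  have hqodd : Odd q := Nat.odd_iff.mpr (by omega)
  have ht' : ∀ i, (![q, p] i).Prime := fun i => by fin_cases i <;> assumption
  have hdp : addLegendreSym 2 p = 1 := addLegendreSym_of_eq_neg_one (jacobiSym_two_eq_neg_one (Or.inr hp5))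
  have hep : addLegendreSym (-1) p = 0 := addLegendreSym_of_eq_one (jacobiSym_neg_one_eq_one hp4)
  have heq : addLegendreSym (-1) q = 1 :=
    addLegendreSym_of_eq_neg_one (DeuringLadic.jacobiSym_neg_one_of_mod_four hq4)
  rcases jacobiSym_eq_one_or_eq_neg_one_of_prime_ne hp hq hne with hj | hj
  · obtain ⟨hqp, hpq⟩ := addLegendreSym_pair_of_jacobiSym_eq_one hp4 hqodd hj
    rcases (show q % 8 = 3 ∨ q % 8 = 7 by omega) with h3 | h7
    · exact monskySelmerRankEven_pair_eq_of_bits _ ht' 0 1 1 1 0 hpq hqp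
        (addLegendreSym_of_eq_neg_one (jacobiSym_two_eq_neg_one (Or.inl h3))) hdp heq hep (by decide +kernel)
    · exact monskySelmerRankEven_pair_eq_of_bits _ ht' 0 0 1 1 0 hpq hqp
        (addLegendreSym_of_eq_one (jacobiSym_two_eq_one (Or.inr h7))) hdp heq hep (by decide +kernel)
  · obtain ⟨hqp, hpq⟩ := addLegendreSym_pair_of_jacobiSym_eq_neg_one hp4 hqodd hj
    rcases (show q % 8 = 3 ∨ q % 8 = 7 by omega) with h3 | h7
    · exact monskySelmerRankEven_pair_eq_of_bits _ ht' 1 1 1 1 0 hpq hqp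
        (addLegendreSym_of_eq_neg_one (jacobiSym_two_eq_neg_one (Or.inl h3))) hdp heq hep (by decide +kernel)
    · exact monskySelmerRankEven_pair_eq_of_bits _ ht' 1 0 1 1 0 hpq hqp
        (addLegendreSym_of_eq_one (jacobiSym_two_eq_one (Or.inr h7))) hdp heq hep (by decide +kernel)

end Monsky

/-! ## §2 AOKI = MONSKY AT `k = 2`: the closed formula equals the matrix count `s + 2` on every cell, and the
`k = 2` instance of Heath-Brown 1994's formula from Aoki's fact -/

section Consistency

variable {p q : ℕ}

/-- **Aoki's closed formula equals Monsky's `s(2pq) + 2` on every ordered pair `p ≡ 1 (mod 4)`, `q ≡ 3 (mod 4)`**: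
`3 = 1 + 2` on the rows `p ≡ 5 (8)` (both signs) and `p ≡ 1 (8)`, `(p/q) = −1`; `5 = 3 + 2` on `p ≡ 1 (8)`,
`(p/q) = +1`. [cite: Aoki1999, Thm. 2.2 p. 81] [cite: HeathBrown1994SelmerCongruentII, Appendix (Monsky), typescript p. 41 L20–L36] -/
theorem selmerDimFormula_two_mul_pair (hp : p.Prime) (hq : q.Prime) (hp4 : p % 4 = 1) (hq4 : q % 4 = 3) :
    selmerDimFormula (2 * (p * q)) = (monskySelmerRankEven ![p, q] : ℤ) + 2 := by
  have hne : p ≠ q := fun h => by omega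
  have hrec : jacobiSym q p = jacobiSym p q :=
    jacobiSym.quadratic_reciprocity_one_mod_four' (hq.odd_of_ne_two (by omega)) hp4
  rcases (show p % 8 = 1 ∨ p % 8 = 5 by omega) with h1 | h5
  · rcases jacobiSym_eq_one_or_eq_neg_one_of_prime_ne hp hq hne with hj | hj
    · rw [selmerDimFormula_one_of_jacobiSym_one hp hq h1 hq4 (hrec ▸ hj),
        (monskySelmerRankEven_one_pair_of_jacobiSym_eq_one hp hq h1 hq4 hj).1]
      norm_num
    · rw [selmerDimFormula_one_of_jacobiSym_neg_one hp hq h1 hq4 (hrec ▸ hj),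
        (monskySelmerRankEven_one_pair_of_jacobiSym_eq_neg_one hp hq h1 hq4 hj).1]
      norm_num
  · rw [selmerDimFormula_two_mul_five_mul hp hq h5 hq4, monskySelmerRankEven_five_pair hp hq h5 hq4]
    norm_num

/-- The swapped order: `selmerDimFormula (2pq) = s(![q, p]) + 2`. [cite: Aoki1999, Thm. 2.2 p. 81]
[cite: HeathBrown1994SelmerCongruentII, Appendix (Monsky), typescript p. 41 L20–L36] -/
theorem selmerDimFormula_two_mul_pair_swap (hp : p.Prime) (hq : q.Prime) (hp4 : p % 4 = 1) (hq4 : q % 4 = 3) :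
    selmerDimFormula (2 * (p * q)) = (monskySelmerRankEven ![q, p] : ℤ) + 2 := by
  have hne : p ≠ q := fun h => by omega
  have hrec : jacobiSym q p = jacobiSym p q :=
    jacobiSym.quadratic_reciprocity_one_mod_four' (hq.odd_of_ne_two (by omega)) hp4
  rcases (show p % 8 = 1 ∨ p % 8 = 5 by omega) with h1 | h5
  · rcases jacobiSym_eq_one_or_eq_neg_one_of_prime_ne hp hq hne with hj | hj
    · rw [selmerDimFormula_one_of_jacobiSym_one hp hq h1 hq4 (hrec ▸ hj),
        (monskySelmerRankEven_one_pair_of_jacobiSym_eq_one hp hq h1 hq4 hj).2]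
      norm_num
    · rw [selmerDimFormula_one_of_jacobiSym_neg_one hp hq h1 hq4 (hrec ▸ hj),
        (monskySelmerRankEven_one_pair_of_jacobiSym_eq_neg_one hp hq h1 hq4 hj).2]
      norm_num
  · rw [selmerDimFormula_two_mul_five_mul hp hq h5 hq4, monskySelmerRankEven_five_pair_swap hp hq h5 hq4]
    norm_num

/-- **The `k = 2` instance of Heath-Brown 1994's formula from Aoki's fact**: for every `k = 2` cell
`n = 2t₀t₁ ≡ 6 (mod 8)` (`t₀ ≠ t₁` primes), `#Sel₂(E_n) = 2^{2 + s(t)}` — `hAo` gives `2^{dim}` with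
`dim = selmerDimFormula n = s(t) + 2` by §2. The even case of `hMe` at two odd primes, from a refereed theorem
with complete proof. [cite: Aoki1999, Thm. 2.2 p. 81] [cite: HeathBrown1994SelmerCongruentII, Appendix (Monsky), typescript p. 41 L20–L36] -/
theorem card_selmerGroup_two_two_mul_prod_two_of_aoki (hAo : thm22_card_selmerGroup_two)
    (t : Fin 2 → ℕ) (ht : ∀ i, (t i).Prime) (hinj : Function.Injective t)
    (h8 : (2 * ∏ i, t i) % 8 = 6) :
    Nat.card ((congruentNumberCurve (2 * ∏ i, t i)).selmerGroup 2) = 2 ^ (2 + monskySelmerRankEven t) := by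
  obtain ⟨p, q, hp, hq, -, hp4, hq4, hpq, htt⟩ := exists_pair_of_two_mul_prod_mod_eight_six t ht hinj h8
  have hprod : ∏ i, t i = p * q := by rw [Fin.prod_univ_two, hpq]
  have hsq := squarefree_two_mul_pair hp hq hp4 hq4
  obtain ⟨d, hd, hd'⟩ := hAo _ (Nat.pos_of_ne_zero hsq.ne_zero) hsq
    (Or.inr (Or.inl (two_mul_pair_mod_eight hp4 hq4)))
  rw [hprod, hd]
  congr 1
  have hdim : (d : ℤ) = (monskySelmerRankEven t : ℤ) + 2 := by
    rw [hd']
    rcases htt with rfl | rfl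
    · exact selmerDimFormula_two_mul_pair hp hq hp4 hq4
    · exact selmerDimFormula_two_mul_pair_swap hp hq hp4 hq4
  omega

end Consistency

end Summit.BirchSwinnertonDyer.Rank1Residual.P2

end
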